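import Summits.CriticalPhenomena.PercolationContinuityZ3.Theorems.PercNearOneGluingNoHeavyLowerTailSahiE3MajPatternRows2
import Mathlib.Data.Fintype.Pi
import Mathlib.Data.Fin.VecNotation
import Mathlib.Tactic.Linarith
import Mathlib.Tactic.FinCases
import HarnessLib
import HarnessLib.Audit

/-!
# `NoHeavyLowerTail` (crux stmt-CriticalPhenomena-4575), Sahi programme P4 (Holley / monotone coupling):
# the maj-slot certificate on the pattern `2³` — combinatorial interface 3/4: Strassen domination and the pair
      condition

Support file (cell `prim-l12`, seat P4, generation 9; `--supports stmt-CriticalPhenomena-4575`).  No named facts,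
      no sorries; standard
axioms; def-free; no notation (the slot set is passed as `(M, hM : M = {110, 101, 011,
      111})`).  Notation and context as in `…SahiE3MajPatternRows`.
* `dominance`: demands `Z·u·ν` on the four points outside `MAJ`,
      capacities `Z(Z+d)ν − R` on `MAJ`: if the capacities are nonnegative,
  the three single-atom Hall inequalities hold and `Σ r = Z²u`,
        every up-set has demand ≤ capacity — the hypothesis of Strassen's theorem
  with slack (`Literature…StrassenHolleyCoupling.exists_subcoupling_of_upperSets_le`),
        which then yields the downward release flow with
  exact deliveries (an up-set containing `⊥` is everything; otherwise its demand sits on the atoms it contains and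
        its capacity contains
  the `MAJ`-points above them).
* `pair_all`: the pair condition for ALL pairs of up-sets of `2³` from the 36 items `ut_*`, `total`,
      `pair_*` of the canonical list
  (trace reduction `…SahiE3PatternReduction.pair_of_saturated` + `sat_cases` + the nine row lemmas).
-/

namespace Summit.CriticalPhenomena.PercolationContinuityZ3.Theorems.SahiE3MajPattern

open Finset
open scoped BigOperators


/-- **Strassen domination for the release flow.**  Demands `dem = Z·u·ν` at the four points outside `MAJ` (zero on
      `MAJ`),
capacities `cap_t = Z(Z+d)n_t − r_t ≥ 0` on `MAJ` (`cap ≥ 0` everywhere): if the three single-atom Hall inequalities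
      hold and the
total retained mass is `Σ r = Z²u`, then every up-set `T` has demand at most capacity (`Z` = total mass, `d`,
      `u` the masses of
`MAJᶜ`, `MAJ`; everything homogeneous of degree three). [this work] -/
theorem dominance (dem cap : (Fin 3 → Bool) → ℝ) (cap0 : ∀ t, 0 ≤ cap t)
    (nE n0 n1 n2 n01 n02 n12 nT Z r01 r02 r12 rT : ℝ) (hZ : 0 ≤ Z) (hnE : 0 ≤ nE)
    (hn0 : 0 ≤ n0) (hn1 : 0 ≤ n1) (hn2 : 0 ≤ n2) (hn01 : 0 ≤ n01) (hn02 : 0 ≤ n02) (hn12 : 0 ≤ n12) (hnT : 0 ≤ nT)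
    (dE : dem ![false, false, false] = Z * (n01 + n02 + n12 + nT) * nE) (d0 : dem ![true, false,
          false] = Z * (n01 + n02 + n12 + nT) * n0)
    (d1 : dem ![false, true, false] = Z * (n01 + n02 + n12 + nT) * n1) (d2 : dem ![false, false,
          true] = Z * (n01 + n02 + n12 + nT) * n2)
    (d01 : dem ![true, true, false] = 0) (d02 : dem ![true, false, true] = 0) (d12 : dem ![false, true,
          true] = 0) (dT : dem ![true, true, true] = 0)
    (k01 : cap ![true, true, false] = Z * (Z + (nE + n0 + n1 + n2)) * n01 - r01) (k02 : cap ![true, false,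
          true] = Z * (Z + (nE + n0 + n1 + n2)) * n02 - r02)
    (k12 : cap ![false, true, true] = Z * (Z + (nE + n0 + n1 + n2)) * n12 - r12) (kT : cap ![true, true,
          true] = Z * (Z + (nE + n0 + n1 + n2)) * nT - rT)
    (hall0 : Z * (n01 + n02 + n12 + nT) * n0 ≤ (Z * (Z + (nE + n0 + n1 + n2)) * n01 - r01) +
      (Z * (Z + (nE + n0 + n1 + n2)) * n02 - r02) + (Z * (Z + (nE + n0 + n1 + n2)) * nT - rT))
    (hall1 : Z * (n01 + n02 + n12 + nT) * n1 ≤ (Z * (Z + (nE + n0 + n1 + n2)) * n01 - r01) +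
      (Z * (Z + (nE + n0 + n1 + n2)) * n12 - r12) + (Z * (Z + (nE + n0 + n1 + n2)) * nT - rT))
    (hall2 : Z * (n01 + n02 + n12 + nT) * n2 ≤ (Z * (Z + (nE + n0 + n1 + n2)) * n02 - r02) +
      (Z * (Z + (nE + n0 + n1 + n2)) * n12 - r12) + (Z * (Z + (nE + n0 + n1 + n2)) * nT - rT))
    (htot : r01 + r02 + r12 + rT = Z * Z * (n01 + n02 + n12 + nT)) :
    ∀ T : Finset (Fin 3 → Bool), IsUpperSet (T : Set (Fin 3 → Bool)) → ∑ z ∈ T, dem z ≤ ∑ z ∈ T, cap z := by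
  obtain ⟨hbot, htop, l001, l002, l101, l112, l202, l212, -, -, -⟩ := ord
  intro T hT
  have up : ∀ {x y : Fin 3 → Bool}, x ≤ y → x ∈ T → y ∈ T := fun hxy hx => hT hxy hx
  have hU : (0:ℝ) ≤ n01 + n02 + n12 + nT := by linarith
  -- the demand of `T` sits on the four points outside `MAJ`
  have S_dem : ∑ z ∈ T, dem z = (if ![false, false, false] ∈ T then dem ![false, false, false] else 0) + ((if ![true,
        false, false] ∈ T then dem ![true, false, false] else 0) +
      ((if ![false, true, false] ∈ T then dem ![false, true, false] else 0) + (if ![false, false,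
            true] ∈ T then dem ![false, false, true] else 0))) := by
    have e1 : ∑ z ∈ ({![false, false, false], ![true, false, false], ![false, true, false], ![false, false,
          true]} : Finset (Fin 3 → Bool)).filter (· ∈ T), dem z = ∑ z ∈ T, dem z := by
      refine Finset.sum_subset (fun x hx => (Finset.mem_filter.1 hx).2) fun x hxT hx => ?_
      have hx' : x ∉ ({![false, false, false], ![true, false, false], ![false, true, false], ![false, false,
            true]} : Finset (Fin 3 → Bool)) := fun h => hx (Finset.mem_filter.2 ⟨h, hxT⟩)
      rcases pts x with rfl | rfl | rfl | rfl | rfl | rfl | rfl | rfl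
      · exact absurd (by simp) hx'
      · exact absurd (by simp) hx'
      · exact absurd (by simp) hx'
      · exact absurd (by simp) hx'
      · exact d01
      · exact d02
      · exact d12
      · exact dT
    rw [← e1, Finset.sum_filter, Finset.sum_insert (by simp), Finset.sum_insert (by simp),
          Finset.sum_insert (by simp),
      Finset.sum_singleton]
  -- the capacity of `T` is at least that of its `MAJ`-part
  have S_cap : (if ![true, true, false] ∈ T then cap ![true, true, false] else 0) + ((if ![true, false,
        true] ∈ T then cap ![true, false, true] else 0) +
      ((if ![false, true, true] ∈ T then cap ![false, true, true] else 0) + (if ![true, true,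
            true] ∈ T then cap ![true, true, true] else 0))) ≤ ∑ z ∈ T, cap z := by
    have e1 : ∑ z ∈ (({![true, true, false], ![true, false, true], ![false, true, true], ![true, true,
          true]} : Finset (Fin 3 → Bool))).filter (· ∈ T), cap z ≤ ∑ z ∈ T, cap z :=
      Finset.sum_le_sum_of_subset_of_nonneg (fun x hx => (Finset.mem_filter.1 hx).2) fun z _ _ => cap0 z
    rwa [Finset.sum_filter, Finset.sum_insert (by simp), Finset.sum_insert (by simp), Finset.sum_insert (by simp),
      Finset.sum_singleton] at e1
  have g01 : 0 ≤ (if ![true, true, false] ∈ T then cap ![true, true, false] else 0) := by split_ifs; exacts [cap0 _,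
        le_rfl]
  have g02 : 0 ≤ (if ![true, false, true] ∈ T then cap ![true, false, true] else 0) := by split_ifs; exacts [cap0 _,
        le_rfl]
  have g12 : 0 ≤ (if ![false, true, true] ∈ T then cap ![false, true, true] else 0) := by split_ifs; exacts [cap0 _,
        le_rfl]
  have gT : 0 ≤ (if ![true, true, true] ∈ T then cap ![true, true, true] else 0) := by split_ifs; exacts [cap0 _,
        le_rfl]
  have pEU : 0 ≤ Z * (n01 + n02 + n12 + nT) * nE := mul_nonneg (mul_nonneg hZ hU) hnE
  have p0U : 0 ≤ Z * (n01 + n02 + n12 + nT) * n0 := mul_nonneg (mul_nonneg hZ hU) hn0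
  have p1U : 0 ≤ Z * (n01 + n02 + n12 + nT) * n1 := mul_nonneg (mul_nonneg hZ hU) hn1
  have p2U : 0 ≤ Z * (n01 + n02 + n12 + nT) * n2 := mul_nonneg (mul_nonneg hZ hU) hn2
  by_cases hb : ![false, false, false] ∈ T
  · -- `T = univ`
    have m : ∀ x, x ∈ T := fun x => up (hbot x) hb
    rw [if_pos hb, if_pos (m _), if_pos (m _), if_pos (m _), dE, d0, d1, d2] at S_dem
    rw [if_pos (m _), if_pos (m _), if_pos (m _), if_pos (m _), k01, k02, k12, kT] at S_cap
    linarith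
  rw [if_neg hb] at S_dem
  by_cases a0 : ![true, false, false] ∈ T <;> by_cases a1 : ![false, true, false] ∈ T <;> by_cases a2 : ![false,
        false, true] ∈ T <;>
    simp only [a0, a1, a2, if_true, if_false, d0, d1, d2] at S_dem
  · -- 0 1 2
    rw [if_pos (up l001 a0), if_pos (up l002 a0), if_pos (up l112 a1), if_pos (up (htop _) a0), k01, k02, k12,
          kT] at S_cap
    linarith
  · -- 0 1
    rw [if_pos (up l001 a0), if_pos (up l002 a0), if_pos (up l112 a1), if_pos (up (htop _) a0), k01, k02, k12,
          kT] at S_cap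
    linarith
  · -- 0 2
    rw [if_pos (up l001 a0), if_pos (up l002 a0), if_pos (up l212 a2), if_pos (up (htop _) a0), k01, k02, k12,
          kT] at S_cap
    linarith
  · -- 0
    rw [if_pos (up l001 a0), if_pos (up l002 a0), if_pos (up (htop _) a0), k01, k02, kT] at S_cap
    linarith
  · -- 1 2
    rw [if_pos (up l101 a1), if_pos (up l202 a2), if_pos (up l112 a1), if_pos (up (htop _) a1), k01, k02, k12,
          kT] at S_cap
    linarith
  · -- 1
    rw [if_pos (up l101 a1), if_pos (up l112 a1), if_pos (up (htop _) a1), k01, k12, kT] at S_cap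
    linarith
  · -- 2
    rw [if_pos (up l202 a2), if_pos (up l212 a2), if_pos (up (htop _) a2), k02, k12, kT] at S_cap
    linarith
  · -- none
    linarith

/-- `({![true, true, false], ![true, false, true], ![false, true, true], ![true, true,
      true]} : Finset (Fin 3 → Bool))` is an up-set of the pattern. [folklore] -/
theorem isUpperSet_maj (M : Finset (Fin 3 → Bool))
    (hM : M = {![true, true, false], ![true, false, true], ![false, true, true], ![true, true,
          true]}) : IsUpperSet ((M : Finset (Fin 3 → Bool)) : Set (Fin 3 → Bool)) := by
  subst hM
  letI : DecidableLE (Fin 3 → Bool) := fun a b => inferInstanceAs (Decidable (∀ i, a i ≤ b i))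
  have h : ∀ a b : Fin 3 → Bool, a ≤ b → a ∈ ({![true, true, false], ![true, false, true], ![false, true, true],
        ![true, true, true]} : Finset (Fin 3 → Bool)) → b ∈ ({![true, true, false], ![true, false, true], ![false,
        true, true], ![true, true, true]} : Finset (Fin 3 → Bool)) := by decide
  intro a b hab ha
  exact h a b hab ha

/-- **PAIR for all pairs of up-sets from the finite list.**  With `Z = 1`, exact deliveries,
      and retained masses `R` taking the
values `r01, r02, r12, rT` on `({![true, true, false], ![true, false, true], ![false, true, true], ![true, true,
      true]} : Finset (Fin 3 → Bool))`, the items `ut_*`, `total`,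
      `pair_*` of the canonical list imply the pair condition of
`…SahiE3PatternCertificate.phi_nonneg_of_patternCertificate` for every pair of up-sets of `2³` (trace reduction
`…SahiE3PatternReduction.pair_of_saturated` + the nine saturated up-sets of `sat_cases`, row by row). [this work] -/
theorem pair_all (M : Finset (Fin 3 → Bool))
    (hM : M = {![true, true, false], ![true, false, true], ![false, true, true], ![true, true,
          true]}) (ν : (Fin 3 → Bool) → ℝ) (hν0 : ∀ t, 0 ≤ ν t) (hν : ∀ a b, ν a * ν b ≤ ν (a ⊓ b) * ν (a ⊔ b))
    (nE n0 n1 n2 n01 n02 n12 nT Z : ℝ) (hZ : ∑ t, ν t = Z)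
    (h0 : ν ![true, false, false] = n0) (h1 : ν ![false, true, false] = n1) (h2 : ν ![false, false, true] = n2)
    (h01 : ν ![true, true, false] = n01) (h02 : ν ![true, false, true] = n02) (h12 : ν ![false, true,
          true] = n12) (hT : ν ![true, true, true] = nT) (r01 r02 r12 rT : ℝ)
    (R : (Fin 3 → Bool) → ℝ) (hR01 : R ![true, true, false] = r01) (hR02 : R ![true, false,
          true] = r02) (hR12 : R ![false, true, true] = r12) (hRT : R ![true, true, true] = rT)
    (Fl : (Fin 3 → Bool) → (Fin 3 → Bool) → ℝ)
    (hKeq : ∀ s ∈ Mᶜ, ∑ t ∈ M, Fl t s = (∑ r, ν r) * (∑ r ∈ M, ν r) * ν s)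
    (H :
      0 ≤ r01 ∧
      0 ≤ r02 ∧
      0 ≤ r12 ∧
      0 ≤ rT ∧
      r01 ≤ Z * (Z + (nE + n0 + n1 + n2)) * n01 ∧
      r02 ≤ Z * (Z + (nE + n0 + n1 + n2)) * n02 ∧
      r12 ≤ Z * (Z + (nE + n0 + n1 + n2)) * n12 ∧
      rT ≤ Z * (Z + (nE + n0 + n1 + n2)) * nT ∧
      Z * (n01 + n02 + n12 + nT) * n0 ≤ (Z * (Z + (nE + n0 + n1 + n2)) * n01 - r01) + (Z * (Z + (nE + n0 + n1 +
            n2)) * n02 - r02) + (Z * (Z + (nE + n0 + n1 + n2)) * nT - rT) ∧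
      Z * (n01 + n02 + n12 + nT) * n1 ≤ (Z * (Z + (nE + n0 + n1 + n2)) * n01 - r01) + (Z * (Z + (nE + n0 + n1 +
            n2)) * n12 - r12) + (Z * (Z + (nE + n0 + n1 + n2)) * nT - rT) ∧
      Z * (n01 + n02 + n12 + nT) * n2 ≤ (Z * (Z + (nE + n0 + n1 + n2)) * n02 - r02) + (Z * (Z + (nE + n0 + n1 +
            n2)) * n12 - r12) + (Z * (Z + (nE + n0 + n1 + n2)) * nT - rT) ∧
      r01 + r02 + r12 + rT = Z * Z * (n01 + n02 + n12 + nT) ∧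
      Z * Z * nT ≤ rT ∧
      Z * Z * (n01 + nT) ≤ r01 + rT ∧
      Z * Z * (n02 + nT) ≤ r02 + rT ∧
      Z * Z * (n12 + nT) ≤ r12 + rT ∧
      Z * Z * (n01 + n02 + nT) ≤ r01 + r02 + rT ∧
      Z * Z * (n01 + n12 + nT) ≤ r01 + r12 + rT ∧
      Z * Z * (n02 + n12 + nT) ≤ r02 + r12 + rT ∧
      Z * (nT * nT + nT * nT) - (n01 + n02 + n12 + nT) * nT * nT ≤ rT ∧
      Z * (nT * (n01 + nT) + (n01 + nT) * nT) - (n01 + n02 + n12 + nT) * nT * (n01 + nT) ≤ rT ∧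
      Z * (nT * (n02 + nT) + (n02 + nT) * nT) - (n01 + n02 + n12 + nT) * nT * (n02 + nT) ≤ rT ∧
      Z * (nT * (n12 + nT) + (n12 + nT) * nT) - (n01 + n02 + n12 + nT) * nT * (n12 + nT) ≤ rT ∧
      Z * (nT * (n01 + n02 + nT) + (n0 + n01 + n02 + nT) * nT) - (n01 + n02 + n12 + nT) * nT * (n0 + n01 + n02 +
            nT) ≤ rT ∧
      Z * (nT * (n01 + n12 + nT) + (n1 + n01 + n12 + nT) * nT) - (n01 + n02 + n12 + nT) * nT * (n1 + n01 + n12 +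
            nT) ≤ rT ∧
      Z * (nT * (n02 + n12 + nT) + (n2 + n02 + n12 + nT) * nT) - (n01 + n02 + n12 + nT) * nT * (n2 + n02 + n12 +
            nT) ≤ rT ∧
      Z * ((n01 + nT) * (n01 + nT) + (n01 + nT) * (n01 + nT)) - (n01 + n02 + n12 + nT) * (n01 + nT) * (n01 +
            nT) ≤ r01 + rT ∧
      Z * ((n02 + nT) * (n02 + nT) + (n02 + nT) * (n02 + nT)) - (n01 + n02 + n12 + nT) * (n02 + nT) * (n02 +
            nT) ≤ r02 + rT ∧
      Z * ((n12 + nT) * (n12 + nT) + (n12 + nT) * (n12 + nT)) - (n01 + n02 + n12 + nT) * (n12 + nT) * (n12 +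
            nT) ≤ r12 + rT ∧
      Z * ((n01 + nT) * (n02 + nT) + (n02 + nT) * (n01 + nT)) - (n01 + n02 + n12 + nT) * (n01 + nT) * (n02 +
            nT) ≤ rT ∧
      Z * ((n01 + nT) * (n12 + nT) + (n12 + nT) * (n01 + nT)) - (n01 + n02 + n12 + nT) * (n01 + nT) * (n12 +
            nT) ≤ rT ∧
      Z * ((n02 + nT) * (n12 + nT) + (n12 + nT) * (n02 + nT)) - (n01 + n02 + n12 + nT) * (n02 + nT) * (n12 +
            nT) ≤ rT ∧
      Z * ((n01 + nT) * (n01 + n02 + nT) + (n0 + n01 + n02 + nT) * (n01 + nT)) - (n01 + n02 + n12 + nT) * (n01 +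
            nT) * (n0 + n01 + n02 + nT) ≤ r01 + rT ∧
      Z * ((n01 + nT) * (n01 + n12 + nT) + (n1 + n01 + n12 + nT) * (n01 + nT)) - (n01 + n02 + n12 + nT) * (n01 +
            nT) * (n1 + n01 + n12 + nT) ≤ r01 + rT ∧
      Z * ((n02 + nT) * (n01 + n02 + nT) + (n0 + n01 + n02 + nT) * (n02 + nT)) - (n01 + n02 + n12 + nT) * (n02 +
            nT) * (n0 + n01 + n02 + nT) ≤ r02 + rT ∧
      Z * ((n02 + nT) * (n02 + n12 + nT) + (n2 + n02 + n12 + nT) * (n02 + nT)) - (n01 + n02 + n12 + nT) * (n02 +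
            nT) * (n2 + n02 + n12 + nT) ≤ r02 + rT ∧
      Z * ((n12 + nT) * (n01 + n12 + nT) + (n1 + n01 + n12 + nT) * (n12 + nT)) - (n01 + n02 + n12 + nT) * (n12 +
            nT) * (n1 + n01 + n12 + nT) ≤ r12 + rT ∧
      Z * ((n12 + nT) * (n02 + n12 + nT) + (n2 + n02 + n12 + nT) * (n12 + nT)) - (n01 + n02 + n12 + nT) * (n12 +
            nT) * (n2 + n02 + n12 + nT) ≤ r12 + rT ∧
      Z * ((n01 + nT) * (n02 + n12 + nT) + (n2 + n02 + n12 + nT) * (n01 + nT)) - (n01 + n02 + n12 + nT) * (n01 +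
            nT) * (n2 + n02 + n12 + nT) ≤ rT ∧
      Z * ((n02 + nT) * (n01 + n12 + nT) + (n1 + n01 + n12 + nT) * (n02 + nT)) - (n01 + n02 + n12 + nT) * (n02 +
            nT) * (n1 + n01 + n12 + nT) ≤ rT ∧
      Z * ((n12 + nT) * (n01 + n02 + nT) + (n0 + n01 + n02 + nT) * (n12 + nT)) - (n01 + n02 + n12 + nT) * (n12 +
            nT) * (n0 + n01 + n02 + nT) ≤ rT ∧
      Z * ((n0 + n01 + n02 + nT) * (n01 + n02 + nT) + (n0 + n01 + n02 + nT) * (n01 + n02 + nT)) - (n01 + n02 + n12 +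
            nT) * (n0 + n01 + n02 + nT) * (n0 + n01 + n02 + nT) ≤ r01 + r02 + rT ∧
      Z * ((n1 + n01 + n12 + nT) * (n01 + n12 + nT) + (n1 + n01 + n12 + nT) * (n01 + n12 + nT)) - (n01 + n02 + n12 +
            nT) * (n1 + n01 + n12 + nT) * (n1 + n01 + n12 + nT) ≤ r01 + r12 + rT ∧
      Z * ((n2 + n02 + n12 + nT) * (n02 + n12 + nT) + (n2 + n02 + n12 + nT) * (n02 + n12 + nT)) - (n01 + n02 + n12 +
            nT) * (n2 + n02 + n12 + nT) * (n2 + n02 + n12 + nT) ≤ r02 + r12 + rT ∧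
      Z * ((n0 + n01 + n02 + nT) * (n01 + n12 + nT) + (n1 + n01 + n12 + nT) * (n01 + n02 + nT)) - (n01 + n02 + n12 +
            nT) * (n0 + n01 + n02 + nT) * (n1 + n01 + n12 + nT) ≤ r01 + rT ∧
      Z * ((n0 + n01 + n02 + nT) * (n02 + n12 + nT) + (n2 + n02 + n12 + nT) * (n01 + n02 + nT)) - (n01 + n02 + n12 +
            nT) * (n0 + n01 + n02 + nT) * (n2 + n02 + n12 + nT) ≤ r02 + rT ∧
      Z * ((n1 + n01 + n12 + nT) * (n02 + n12 + nT) + (n2 + n02 + n12 + nT) * (n01 + n12 + nT)) - (n01 + n02 + n12 +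
            nT) * (n1 + n01 + n12 + nT) * (n2 + n02 + n12 + nT) ≤ r12 + rT) :
    ∀ S S' : Finset (Fin 3 → Bool), IsUpperSet (S : Set (Fin 3 → Bool)) → IsUpperSet (S' : Set (Fin 3 → Bool)) →
      (∑ r, ν r) * ((∑ t ∈ S, ν t) * (∑ t ∈ S' ∩ M, ν t) + (∑ t ∈ S', ν t) * (∑ t ∈ S ∩ M, ν t))
          - (∑ r ∈ M, ν r) * (∑ t ∈ S, ν t) * (∑ t ∈ S', ν t)
        ≤ ∑ t ∈ (S ∩ S') ∩ M, R t + ∑ s ∈ (S ∩ S') ∩ Mᶜ, (∑ t ∈ M, Fl t s - (∑ r, ν r) * (∑ r ∈ M, ν r) * ν s) := by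
  subst hM
  letI : DecidableLE (Fin 3 → Bool) := fun a b => inferInstanceAs (Decidable (∀ i, a i ≤ b i))
  obtain ⟨-, -, -, -, -, -, -, -, -, -, -, h_total, h_ut_T, h_ut_01, h_ut_02, h_ut_12, h_ut_R0, h_ut_R1, h_ut_R2,
        h_pair_T_T, h_pair_T_P01, h_pair_T_P02, h_pair_T_P12, h_pair_T_R0, h_pair_T_R1, h_pair_T_R2, h_pair_P01_P01,
        h_pair_P02_P02, h_pair_P12_P12, h_pair_P01_P02, h_pair_P01_P12, h_pair_P02_P12, h_pair_P01_R0, h_pair_P01_R1,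
        h_pair_P02_R0, h_pair_P02_R2, h_pair_P12_R1, h_pair_P12_R2, h_pair_P01_R2, h_pair_P02_R1, h_pair_P12_R0,
        h_pair_R0_R0, h_pair_R1_R1, h_pair_R2_R2, h_pair_R0_R1, h_pair_R0_R2, h_pair_R1_R2⟩ := H
  refine SahiE3PatternReduction.pair_of_saturated _ (isUpperSet_maj _ rfl) ν R Fl hν0 hν hKeq ?_
  intro S S' hS hS' hsS hsS'
  have hK0 : ∀ X : Finset (Fin 3 → Bool),
      ∑ s ∈ X ∩ ({![true, true, false], ![true, false, true], ![false, true, true], ![true, true,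
            true]} : Finset (Fin 3 → Bool))ᶜ, (∑ t ∈ ({![true, true, false], ![true, false, true], ![false, true,
            true], ![true, true, true]} : Finset (Fin 3 → Bool)), Fl t s - (∑ r, ν r) * (∑ r ∈ ({![true, true,
            false], ![true, false, true], ![false, true, true], ![true, true, true]} : Finset (Fin 3 → Bool)),
            ν r) * ν s) = 0 := fun X =>
    Finset.sum_eq_zero fun s hs => by rw [hKeq s (Finset.mem_of_mem_inter_right hs), sub_self]
  have hU : ∑ r ∈ ({![true, true, false], ![true, false, true], ![false, true, true], ![true, true,
        true]} : Finset (Fin 3 → Bool)), ν r = n01 + n02 + n12 + nT := by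
    rw [Finset.sum_insert (by simp), Finset.sum_insert (by simp), Finset.sum_insert (by simp), Finset.sum_singleton,
      h01, h02, h12, hT]
    ring
  rw [hK0, add_zero, hU, hZ]
  rcases sat_cases _ rfl S hS hsS with rfl | rfl | rfl | rfl | rfl | rfl | rfl | rfl | rfl
  · exact pair_row_empty _ rfl ν n0 n1 n2 n01 n02 n12 nT Z hZ h0 h1 h2 h01 h02 h12 hT  R   S' hS' hsS'
  · exact pair_row_T _ rfl ν n0 n1 n2 n01 n02 n12 nT Z hZ h0 h1 h2 h01 h02 h12 hT rT R hRT h_pair_T_T h_pair_T_P01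
        h_pair_T_P02 h_pair_T_P12 h_pair_T_R0 h_pair_T_R1 h_pair_T_R2 h_ut_T S' hS' hsS'
  · exact pair_row_P01 _ rfl ν n0 n1 n2 n01 n02 n12 nT Z hZ h0 h1 h2 h01 h02 h12 hT r01 rT R hR01 hRT h_pair_T_P01
        h_pair_P01_P01 h_pair_P01_P02 h_pair_P01_P12 h_pair_P01_R0 h_pair_P01_R1 h_pair_P01_R2 h_ut_01 S' hS' hsS'
  · exact pair_row_P02 _ rfl ν n0 n1 n2 n01 n02 n12 nT Z hZ h0 h1 h2 h01 h02 h12 hT r02 rT R hR02 hRT h_pair_T_P02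
        h_pair_P01_P02 h_pair_P02_P02 h_pair_P02_P12 h_pair_P02_R0 h_pair_P02_R1 h_pair_P02_R2 h_ut_02 S' hS' hsS'
  · exact pair_row_P12 _ rfl ν n0 n1 n2 n01 n02 n12 nT Z hZ h0 h1 h2 h01 h02 h12 hT r12 rT R hR12 hRT h_pair_T_P12
        h_pair_P01_P12 h_pair_P02_P12 h_pair_P12_P12 h_pair_P12_R0 h_pair_P12_R1 h_pair_P12_R2 h_ut_12 S' hS' hsS'
  · exact pair_row_R0 _ rfl ν n0 n1 n2 n01 n02 n12 nT Z hZ h0 h1 h2 h01 h02 h12 hT r01 r02 rT R hR01 hR02 hRT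
        h_pair_T_R0 h_pair_P01_R0 h_pair_P02_R0 h_pair_P12_R0 h_pair_R0_R0 h_pair_R0_R1 h_pair_R0_R2 h_ut_R0 S' hS'
        hsS'
  · exact pair_row_R1 _ rfl ν n0 n1 n2 n01 n02 n12 nT Z hZ h0 h1 h2 h01 h02 h12 hT r01 r12 rT R hR01 hR12 hRT
        h_pair_T_R1 h_pair_P01_R1 h_pair_P02_R1 h_pair_P12_R1 h_pair_R0_R1 h_pair_R1_R1 h_pair_R1_R2 h_ut_R1 S' hS'
        hsS'
  · exact pair_row_R2 _ rfl ν n0 n1 n2 n01 n02 n12 nT Z hZ h0 h1 h2 h01 h02 h12 hT r02 r12 rT R hR02 hR12 hRT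
        h_pair_T_R2 h_pair_P01_R2 h_pair_P02_R2 h_pair_P12_R2 h_pair_R0_R2 h_pair_R1_R2 h_pair_R2_R2 h_ut_R2 S' hS'
        hsS'
  · exact pair_row_univ _ rfl ν n0 n1 n2 n01 n02 n12 nT Z hZ h0 h1 h2 h01 h02 h12 hT r01 r02 r12 rT R hR01 hR02 hR12
        hRT h_ut_T h_ut_01 h_ut_02 h_ut_12 h_ut_R0 h_ut_R1 h_ut_R2 h_total S' hS' hsS'

end Summit.CriticalPhenomena.PercolationContinuityZ3.Theorems.SahiE3MajPattern
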